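import Mathlib.Algebra.Polynomial.Derivative
import Mathlib.Tactic.FieldSimp
import Mathlib.Tactic.LinearCombination
import HarnessLib

/-!
# Critical points of the Hessian and Cayleyan maps of the Hesse pencil (Artebani–Dolgachev, Remark 3.5)

Topic `Literature/AlgebraicGeometry/PlaneCurves`, namespace `Literature.AlgebraicGeometry.PlaneCurves`.
Lane `lit-hodgefound`, seat `lit-hodgefound-p37`, row g18-#7; a sequel of `HessePencilHessian`
(`det_hessianMatrix_hesse_eq_smul`: `He(H_μ) = −54μ² · H_{𝔥(μ)}`, `𝔥(μ) = (4 − μ³)/(3μ²)`),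
`HessePencilHessianPreimages` (A–D Prop. 3.2) and `HessePencilCayleyan` (A–D Prop. 3.3:
`𝔠(μ) = (μ³ + 2)/(3μ)` in the normalisation `H_μ = X³ + Y³ + Z³ − 3μXYZ`, i.e. `λ = −3μ`).
Everything here is PROVED; no definition, no named fact.

Source followed — M. Artebani, I. Dolgachev, *The Hesse pencil of plane cubic curves*,
L'Enseignement Math. (2) 55 (2009) 235–273 [arXiv:math/0611590, held `paper:arxiv-math_0611590`
p0007 L27–L28], Remark 3.5, VERBATIM:

> Remark 3.5. The iterations of the maps `𝔥 : ℙ¹ → ℙ¹` and `𝔠 : ℙ¹ → ℙ¹` given by (hes) and (cay)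
> were studied in [Hollcroft]. They give interesting examples of complex dynamics in one complex
> variable. The critical points of `𝔥` are the four equianharmonic cubics and its critical values
> correspond to the four triangles. Note that the set of triangles is invariant under this map.
> The set of critical points of `𝔠` is the set of triangles and it coincides with the set of
> critical values. The equianharmonic cubics are mapped to critical points. This shows that both
> maps are critically finite maps in the sense of Thurston (see [McM]).

with (hes) `𝔥(λ) = −(108 + λ³)/(3λ²)` and (cay) `𝔠(λ) = (54 − λ³)/(9λ)` for
`E_λ : x³ + y³ + z³ + λxyz = 0`.

## Dictionary

* We use the tree's parameter `μ = −λ/3` (`H_μ = E_{−3μ}`): `𝔥(μ) = (4 − μ³)/(3μ²)`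
  (`HessePencilHessian`), `𝔠(μ) = (μ³ + 2)/(3μ)` (`HessePencilCayleyan`); the triangles are
  `μ³ = 1` and `μ = ∞`, the equianharmonic members `μ(μ³ + 8) = 0`
  (`HessePencilHarmonicMembers`, `HessePencilInvariants.equianharmonic_parameters`).
* A rational map `φ = f/g : ℙ¹ → ℙ¹` (`f, g` coprime polynomials) is critical at a finite
  parameter `μ` iff the Wronskian `f′g − fg′` vanishes at `μ` (this covers the poles: at a zero
  of `g` the Wronskian is `−f(μ)g′(μ)`, zero iff the pole is multiple); the point `μ = ∞` is
  examined in the chart `s = 1/μ`.  We prove the Wronskian identities as identities in `K[X]`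
  (`Polynomial.derivative`) and evaluate them; "critical point" itself is not defined.

## What is here

* §1 **`𝔥`**: `hessianMap_wronskian` — `(4 − X³)′·3X² − (4 − X³)·(3X²)′ = −3X(X³ + 8)`, so
  (`hessianMap_wronskian_eval_eq_zero_iff`, `3 ≠ 0`) the finite critical points are exactly
  `μ(μ³ + 8) = 0`: **"The critical points of `𝔥` are the four equianharmonic cubics"**; at
  `μ = ∞` (`hessianMap_recip`, `hessianMap_wronskian_at_infinity`: chart `s = 1/μ`,
  `𝔥 = (4s³ − 1)/(3s)`, Wronskian `24s³ + 3`, value `3 ≠ 0` at `s = 0`) the map is unramified.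
  **"its critical values correspond to the four triangles"**: `hessianMap_equianharmonic` —
  `𝔥(−2w) = w` for `w³ = 1` (and `𝔥(0) = ∞`: `hessianMap_zero_pole`, the denominator vanishes
  and the numerator is `4 ≠ 0`). **"the set of triangles is invariant under this map"**:
  `hessianMap_triangle` — `𝔥(w) = w` for `w³ = 1` (each triangle parameter is even fixed), and
  `∞ ↦ ∞` (`hessianMap_recip` at `s = 0`: denominator `0`, numerator `−1`).
* §2 **`𝔠`**: `cayleyanMap_wronskian` — `(X³ + 2)′·3X − (X³ + 2)·(3X)′ = 6(X³ − 1)`: the finite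
  critical points are `μ³ = 1` (`cayleyanMap_wronskian_eval_eq_zero_iff`, `6 ≠ 0`; `μ = 0` is a
  simple pole, Wronskian `−6 ≠ 0`), and `μ = ∞` is critical (`cayleyanMap_recip`:
  `𝔠 = (1 + 2s³)/(3s²)` in `s = 1/μ`, `cayleyanMap_wronskian_recip`: Wronskian `6s(s³ − 1)`,
  zero at `s = 0`): **"The set of critical points of `𝔠` is the set of triangles"**;
  `cayleyanMap_triangle` — `𝔠(w) = w²` for `w³ = 1` (and `∞ ↦ ∞`): **"it coincides with the set
  of critical values"**; `cayleyanMap_equianharmonic` — `𝔠(−2w) = w²` for `w³ = 1` (and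
  `𝔠(0) = ∞`): **"The equianharmonic cubics are mapped to critical points."**

NOT here: the dynamics ([Hollcroft]), Thurston's notion of critically finite map, and the
identification of critical points of `φ` with zeros of the Wronskian (used as the dictionary).
-/

set_option autoImplicit false

open Polynomial

namespace Literature.AlgebraicGeometry.PlaneCurves

universe u

section CriticalPoints

variable {K : Type u} [Field K]

/-! ## §1 The Hessian map `𝔥(μ) = (4 − μ³)/(3μ²)` -/

/-- The Wronskian of `𝔥 = (4 − X³)/(3X²)`: `(4 − X³)′·(3X²) − (4 − X³)·(3X²)′ = −3X(X³ + 8)`.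
[cite: ArtebaniDolgachev2009, Remark 3.5 ("The critical points of `𝔥` are the four
equianharmonic cubics")] -/
theorem hessianMap_wronskian :
    derivative (C 4 - X ^ 3 : K[X]) * (C 3 * X ^ 2) - (C 4 - X ^ 3) * derivative (C 3 * X ^ 2) =
      -(C 3 * X * (X ^ 3 + C 8)) := by
  simp only [derivative_sub, derivative_C, derivative_X_pow, derivative_mul, zero_sub,
    zero_mul, zero_add, Nat.cast_ofNat]
  have e2 : (C 2 : K[X]) = 2 := rfl
  have e3 : (C 3 : K[X]) = 3 := rfl
  have e4 : (C 4 : K[X]) = 4 := rfl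
  have e8 : (C 8 : K[X]) = 8 := rfl
  rw [e2, e3, e4, e8]
  ring

/-- **"The critical points of `𝔥` are the four equianharmonic cubics"**: for `3 ≠ 0` the
Wronskian of `𝔥` vanishes at `μ` iff `μ(μ³ + 8) = 0`, i.e. iff `μ ∈ {0, −2, −2ε, −2ε²}` is an
equianharmonic parameter (`HessePencilInvariants.equianharmonic_parameters`); `μ = ∞` is not
critical (`hessianMap_wronskian_at_infinity`). [cite: ArtebaniDolgachev2009, Remark 3.5] -/
theorem hessianMap_wronskian_eval_eq_zero_iff (h3 : (3 : K) ≠ 0) (μ : K) :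
    eval μ (derivative (C 4 - X ^ 3 : K[X]) * (C 3 * X ^ 2) -
        (C 4 - X ^ 3) * derivative (C 3 * X ^ 2)) = 0 ↔ μ * (μ ^ 3 + 8) = 0 := by
  rw [hessianMap_wronskian]
  simp only [eval_neg, eval_mul, eval_C, eval_X, eval_add, eval_pow, neg_eq_zero, mul_assoc,
    mul_eq_zero, h3, false_or]

/-- `𝔥` in the chart `s = 1/μ` at infinity: `(4 − μ³)/(3μ²) = (4s³ − 1)/(3s)` for `μ = s⁻¹`,
`s ≠ 0`. At `s = 0` the right-hand side has denominator `0` and numerator `−1 ≠ 0`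
(`𝔥(∞) = ∞`: the triangle `xyz = 0` is fixed). [cite: ArtebaniDolgachev2009, Remark 3.5
("the set of triangles is invariant under this map")] -/
theorem hessianMap_recip (h3 : (3 : K) ≠ 0) {s : K} (hs : s ≠ 0) :
    (4 - (s⁻¹) ^ 3) / (3 * (s⁻¹) ^ 2) = (4 * s ^ 3 - 1) / (3 * s) := by
  field_simp

/-- `𝔥` is unramified at `μ = ∞`: the Wronskian of `(4s³ − 1)/(3s)` is `24s³ + 3`, with value
`3 ≠ 0` at `s = 0` (for `3 ≠ 0`). [cite: ArtebaniDolgachev2009, Remark 3.5] -/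
theorem hessianMap_wronskian_at_infinity :
    derivative (C 4 * X ^ 3 - C 1 : K[X]) * (C 3 * X) - (C 4 * X ^ 3 - C 1) * derivative (C 3 * X) =
      C 24 * X ^ 3 + C 3 ∧
    eval 0 (C 24 * X ^ 3 + C 3 : K[X]) = 3 := by
  refine ⟨?_, by simp⟩
  simp only [derivative_sub, derivative_C, derivative_X_pow, derivative_mul, derivative_X,
    sub_zero, zero_mul, zero_add, mul_one, Nat.cast_ofNat]
  have e1 : (C 1 : K[X]) = 1 := rfl
  have e3 : (C 3 : K[X]) = 3 := rfl
  have e4 : (C 4 : K[X]) = 4 := rfl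
  have e24 : (C 24 : K[X]) = 24 := rfl
  rw [e1, e3, e4, e24]
  ring

/-- **"its critical values correspond to the four triangles"**: `𝔥(−2w) = w` for `w³ = 1`
(`12 ≠ 0`) — the equianharmonic member `H_{−2w}` goes to the triangle `H_w`, `w ∈ {1, ε, ε²}`
(and `H_0` goes to the triangle `xyz`: `hessianMap_zero_pole`).
[cite: ArtebaniDolgachev2009, Remark 3.5] -/
theorem hessianMap_equianharmonic (h12 : (12 : K) ≠ 0) {w : K} (hw : w ^ 3 = 1) :
    (4 - (-2 * w) ^ 3) / (3 * (-2 * w) ^ 2) = w := by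
  have hw0 : w ≠ 0 := by rintro rfl; norm_num at hw
  rw [div_eq_iff (by
    rw [show (3 : K) * (-2 * w) ^ 2 = 12 * w ^ 2 by ring]
    exact mul_ne_zero h12 (pow_ne_zero _ hw0))]
  linear_combination (8 - 12 : K) * hw

/-- `𝔥(0) = ∞`: at `μ = 0` the denominator `3μ²` of `𝔥` vanishes and the numerator is `4 ≠ 0`
(for `2 ≠ 0`); the Fermat cubic `H_0` (equianharmonic) goes to the triangle `xyz = 0`, and
`μ = 0` is a double pole, a critical point (`hessianMap_wronskian_eval_eq_zero_iff`).
[cite: ArtebaniDolgachev2009, Remark 3.5] -/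
theorem hessianMap_zero_pole (h2 : (2 : K) ≠ 0) :
    (3 : K) * (0 : K) ^ 2 = 0 ∧ (4 : K) - (0 : K) ^ 3 ≠ 0 := by
  refine ⟨by ring, ?_⟩
  rw [show (4 : K) - (0 : K) ^ 3 = 2 * 2 by ring]
  exact mul_ne_zero h2 h2

/-- **"the set of triangles is invariant under this map"**: `𝔥(w) = w` for `w³ = 1` (`3 ≠ 0`) —
every triangle parameter `1, ε, ε²` is a fixed point of `𝔥` (and `∞ ↦ ∞`, `hessianMap_recip`).
[cite: ArtebaniDolgachev2009, Remark 3.5] -/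
theorem hessianMap_triangle (h3 : (3 : K) ≠ 0) {w : K} (hw : w ^ 3 = 1) :
    (4 - w ^ 3) / (3 * w ^ 2) = w := by
  have hw0 : w ≠ 0 := by rintro rfl; norm_num at hw
  rw [div_eq_iff (mul_ne_zero h3 (pow_ne_zero _ hw0))]
  linear_combination (-1 - 3 : K) * hw

/-! ## §2 The Cayleyan map `𝔠(μ) = (μ³ + 2)/(3μ)` -/

/-- The Wronskian of `𝔠 = (X³ + 2)/(3X)`: `(X³ + 2)′·(3X) − (X³ + 2)·(3X)′ = 6(X³ − 1)`.
[cite: ArtebaniDolgachev2009, Remark 3.5 ("The set of critical points of `𝔠` is the set of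
triangles")] -/
theorem cayleyanMap_wronskian :
    derivative (X ^ 3 + C 2 : K[X]) * (C 3 * X) - (X ^ 3 + C 2) * derivative (C 3 * X) =
      C 6 * (X ^ 3 - C 1) := by
  simp only [derivative_add, derivative_C, derivative_X_pow, derivative_mul, derivative_X,
    add_zero, zero_mul, zero_add, mul_one, Nat.cast_ofNat]
  have e1 : (C 1 : K[X]) = 1 := rfl
  have e2 : (C 2 : K[X]) = 2 := rfl
  have e3 : (C 3 : K[X]) = 3 := rfl
  have e6 : (C 6 : K[X]) = 6 := rfl
  rw [e1, e2, e3, e6]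
  ring

/-- **"The set of critical points of `𝔠` is the set of triangles"** (finite part): for `6 ≠ 0`
the Wronskian of `𝔠` vanishes at `μ` iff `μ³ = 1` (`μ = 0` is a simple pole: the Wronskian is
`−6 ≠ 0` there); the fourth triangle `μ = ∞` is critical by `cayleyanMap_wronskian_recip`.
[cite: ArtebaniDolgachev2009, Remark 3.5] -/
theorem cayleyanMap_wronskian_eval_eq_zero_iff (h6 : (6 : K) ≠ 0) (μ : K) :
    eval μ (derivative (X ^ 3 + C 2 : K[X]) * (C 3 * X) - (X ^ 3 + C 2) * derivative (C 3 * X)) =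
      0 ↔ μ ^ 3 = 1 := by
  rw [cayleyanMap_wronskian]
  simp only [eval_mul, eval_C, eval_sub, eval_X, eval_pow, eval_one, mul_eq_zero, h6, false_or,
    sub_eq_zero, map_one]

/-- `𝔠` in the chart `s = 1/μ`: `(μ³ + 2)/(3μ) = (1 + 2s³)/(3s²)` for `μ = s⁻¹`, `s ≠ 0`; at
`s = 0` the denominator vanishes and the numerator is `1`: `𝔠(∞) = ∞`.
[cite: ArtebaniDolgachev2009, Remark 3.5] -/
theorem cayleyanMap_recip (h3 : (3 : K) ≠ 0) {s : K} (hs : s ≠ 0) :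
    ((s⁻¹) ^ 3 + 2) / (3 * s⁻¹) = (1 + 2 * s ^ 3) / (3 * s ^ 2) := by
  field_simp

/-- `μ = ∞` is a critical point of `𝔠` (a double pole): the Wronskian of `(1 + 2s³)/(3s²)` is
`6s(s³ − 1)`, which vanishes at `s = 0` (and again at the finite triangles `s³ = 1`).
[cite: ArtebaniDolgachev2009, Remark 3.5 ("The set of critical points of `𝔠` is the set of
triangles")] -/
theorem cayleyanMap_wronskian_recip :
    derivative (C 1 + C 2 * X ^ 3 : K[X]) * (C 3 * X ^ 2) -
        (C 1 + C 2 * X ^ 3) * derivative (C 3 * X ^ 2) = C 6 * X * (X ^ 3 - C 1) ∧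
      eval 0 (C 6 * X * (X ^ 3 - C 1) : K[X]) = 0 := by
  refine ⟨?_, by simp⟩
  simp only [derivative_add, derivative_C, derivative_X_pow, derivative_mul, zero_add,
    zero_mul, Nat.cast_ofNat]
  have e1 : (C 1 : K[X]) = 1 := rfl
  have e2 : (C 2 : K[X]) = 2 := rfl
  have e3 : (C 3 : K[X]) = 3 := rfl
  have e6 : (C 6 : K[X]) = 6 := rfl
  rw [e1, e2, e3, e6]
  ring

/-- **"it coincides with the set of critical values"**: `𝔠(w) = w²` for `w³ = 1` (`3 ≠ 0`) —
`𝔠` permutes the triangle parameters `1, ε, ε²` (`w ↦ w² = w⁻¹`) and fixes `∞`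
(`cayleyanMap_recip`), so the critical values of `𝔠` are again the four triangles.
[cite: ArtebaniDolgachev2009, Remark 3.5] -/
theorem cayleyanMap_triangle (h3 : (3 : K) ≠ 0) {w : K} (hw : w ^ 3 = 1) :
    (w ^ 3 + 2) / (3 * w) = w ^ 2 := by
  have hw0 : w ≠ 0 := by rintro rfl; norm_num at hw
  rw [div_eq_iff (mul_ne_zero h3 hw0)]
  linear_combination (1 - 3 : K) * hw

/-- **"The equianharmonic cubics are mapped to critical points"**: `𝔠(−2w) = w²` for `w³ = 1`
(`6 ≠ 0`) — the equianharmonic member `H_{−2w}` goes to the triangle `H_{w²}` — and `𝔠(0) = ∞`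
(the denominator `3μ` vanishes at `μ = 0`, the numerator is `2`): `H_0 ↦ xyz`.
[cite: ArtebaniDolgachev2009, Remark 3.5] -/
theorem cayleyanMap_equianharmonic (h6 : (6 : K) ≠ 0) {w : K} (hw : w ^ 3 = 1) :
    ((-2 * w) ^ 3 + 2) / (3 * (-2 * w)) = w ^ 2 ∧ (3 : K) * 0 = 0 := by
  have hw0 : w ≠ 0 := by rintro rfl; norm_num at hw
  refine ⟨?_, by ring⟩
  rw [div_eq_iff (by
    rw [show (3 : K) * (-2 * w) = -(6 * w) by ring]
    exact neg_ne_zero.mpr (mul_ne_zero h6 hw0))]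
  linear_combination (-8 + 6 : K) * hw

end CriticalPoints

end Literature.AlgebraicGeometry.PlaneCurves
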